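import Summits.RiemannHypothesis.RiemannHypothesis.Theorems.SpectralTraceWindowTraceArchStubCausalCrystallisationAux2
import HarnessLib

/-!
# Causal crystallisation — auxiliary file 3: the alias integrals vanish

Helper file for the stub `stub_causalCrystallisation` of the line `causal-level-sets` for the
crux `WindowTraceArch` (stmt-RiemannHypothesis-11195; skeleton
`Summit.RiemannHypothesis.RiemannHypothesis.Cruxes.WindowTraceArch.CausalLevelSets`; the stub is
proved in `Theorems/SpectralTraceWindowTraceArchStubCausalCrystallisation.lean`).

* `causalCLS_alias_zero` (registered sub-goal) : for a Hermite–Biehler `E` zero-free on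
  `Im z ≥ -δ` with `‖E'/E‖ ≤ C(1+|t|)^N` on `ℝ` and phase `θ` (`E = |E| e^{iθ}`, `θ' = Im E'/E`),
  a tilt `L > 0`, a window `A < 2L`, a Weil test `h` supported in `[-A, A]`, any `α` and any
  integer `m ≠ 0`: `∫ ĥ(t) φ̃'(t) e^{2im(α - φ̃(t))} dt = 0` with `φ̃ = Lt - θ`,
  `φ̃' = L - Im E'/E`. Proof: `φ̃' e^{-2imφ̃} = (e^{-2imφ̃})'/(-2im)`; integrate by parts on `ℝ`
  (`MeasureTheory.integral_mul_deriv_eq_deriv_mul_of_integrable`, `ĥ' = i(xh)^` by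
  `hasDerivAt_weilMellin` along the critical line; integrability from the Schwartz decay of `ĥ`, `(xh)^` and the
  polynomial bound on `φ̃'`); on `ℝ`, `e^{2iθ} = E/E♯`, so `e^{-2imφ̃} = (e^{-2iLt}E/E♯)^m`
  (`m ≥ 1`) or `(e^{2iLt}E♯/E)^{|m|}` (`m ≤ -1`), and the remaining integrals vanish by
  `causalCLS_alias_lower` / `causalCLS_alias_upper`.

**Sources.** Folklore (integration by parts; de Branges' inner function `Θ = E♯/E`).
-/

set_option linter.dupNamespace false

noncomputable section

open Complex Set MeasureTheory Filter
open scoped Real Topology ComplexConjugate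

namespace Summit.RiemannHypothesis.RiemannHypothesis.Theorems.SpectralTraceWindowTraceArch

open Literature.NumberTheory.LFunctions
open Literature.Analysis.DeBrangesSpaces (IsHermiteBiehler sharp)
/-! ### The alias integrals of the crystallisation identity vanish -/

/-- **The alias integrals vanish (after one integration by parts).** For a Hermite–Biehler `E`
without zeros on `Im z ≥ -δ`, with `‖E'/E‖ ≤ C(1+|t|)^N` on the real axis and a phase `θ`
(`E(t) = |E(t)| e^{iθ(t)}`, `θ' = Im (E'/E)`), a tilt `L > 0`, a window `A < 2L`, a Weil test `h`
supported in `[-A, A]` and an integer `m ≠ 0`: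
`∫ ĥ(t) φ̃'(t) e^{2im(α - φ̃(t))} dt = 0`, where `φ̃(t) = Lt - θ(t)`, `φ̃' = L - Im (E'/E)`.
Write `φ̃' e^{-2imφ̃} = (e^{-2imφ̃})'/(-2im)` and integrate by parts
(`integral_mul_deriv_eq_deriv_mul_of_integrable`; `ĥ' = i (x h)^`, `hasDerivAt_weilMellin`);
since `e^{2iθ} = E/E♯` on `ℝ`, `e^{-2imφ̃(t)} = (e^{-2iLt} E/E♯)^m` for `m ≥ 1` and
`= (e^{2iLt} E♯/E)^{|m|}` for `m ≤ -1`, and the remaining integrals are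
`causalCLS_alias_lower` / `causalCLS_alias_upper`. -/
theorem causalCLS_alias_zero :
    ∀ (E : ℂ → ℂ) (δ C : ℝ) (N : ℕ) (θ : ℝ → ℝ) (L A : ℝ) (h : ℝ → ℂ) (α : ℝ) (m : ℤ),
      IsHermiteBiehler E → 0 < δ → (∀ z : ℂ, -δ ≤ z.im → E z ≠ 0) →
      (∀ t : ℝ, ‖deriv E t / E t‖ ≤ C * (1 + |t|) ^ N) →
      (∀ t : ℝ, HasDerivAt θ (deriv E t / E t).im t) →
      (∀ t : ℝ, E t = ((‖E t‖ : ℝ) : ℂ) * cexp (((θ t : ℝ) : ℂ) * I)) →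
      0 < L → A < 2 * L → IsWeilTest h → tsupport h ⊆ Icc (-A) A → m ≠ 0 →
      ∫ t : ℝ, weilMellin h (1 / 2 + (t : ℂ) * I) * ((L - (deriv E t / E t).im : ℝ) : ℂ) *
        cexp (((2 * (m : ℝ) * (α - (L * t - θ t)) : ℝ) : ℂ) * I) = 0 := by
  intro E δ C N θ L A h α m hE hδ h0 hgr hθd hθ hL hAL hh hhA hm
  have h0r : ∀ t : ℝ, E t ≠ 0 := fun t => h0 t (by simp; exact hδ.le)
  have hC : 0 ≤ C := by
    have h := (norm_nonneg _).trans (hgr 0)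
    simpa using h
  -- notation
  set ℓ : ℝ → ℂ := fun t => deriv E t / E t with hℓ
  set ph : ℝ → ℝ := fun t => L * t - θ t with hph
  set ph' : ℝ → ℝ := fun t => L - (ℓ t).im with hph'
  have hℓc : Continuous ℓ := by
    have h1 : Continuous (deriv E) :=
      (hE.differentiable.contDiff (n := 1)).continuous_deriv le_rfl
    exact (h1.comp continuous_ofReal).div (hE.differentiable.continuous.comp continuous_ofReal) h0r
  have hder : ∀ t, HasDerivAt ph (ph' t) t := fun t => by
    have h1 : HasDerivAt (fun s : ℝ => L * s - θ s) (L * 1 - (deriv E t / E t).im) t :=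
      ((hasDerivAt_id t).const_mul L).fun_sub (hθd t)
    simp only [hph, hph', hℓ]
    convert h1 using 1
    ring
  have hθc : Continuous θ := continuous_iff_continuousAt.2 fun t => (hθd t).continuousAt
  have hph'c : Continuous ph' := continuous_const.sub (Complex.continuous_im.comp hℓc)
  have hph'b : ∀ t, |ph' t| ≤ L + C * (1 + |t|) ^ N := by
    intro t
    have h1 : |(ℓ t).im| ≤ ‖ℓ t‖ := Complex.abs_im_le_norm _
    have h2 := hgr t
    have h3 : |ph' t| ≤ |L| + |(ℓ t).im| := by
      simp only [hph']
      exact abs_sub _ _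
    rw [abs_of_pos hL] at h3
    linarith
  -- the test function `k(x) = x h(x)` and the derivative of `ĥ` along the line
  set u : ℝ → ℂ := fun t => weilMellin h (1 / 2 + (t : ℂ) * I) with hu
  set k : ℝ → ℂ := fun x => (x : ℂ) * h x with hk
  have hkW : IsWeilTest k := ⟨Complex.ofRealCLM.contDiff.mul hh.1, hh.2.mul_left⟩
  have hkA : tsupport k ⊆ Icc (-A) A := (tsupport_mul_subset_right).trans hhA
  set u' : ℝ → ℂ := fun t => I * weilMellin k (1 / 2 + (t : ℂ) * I) with hu'
  have hud : ∀ t, HasDerivAt u (u' t) t := by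
    -- `d/dt ĥ(1/2 + it) = i (x h)^(1/2 + it)` (differentiate under the integral sign,
    -- `hasDerivAt_weilMellin`, along the line `t ↦ 1/2 + it`)
    intro t
    have h1 : HasDerivAt (fun v : ℝ => (1 / 2 : ℂ) + (v : ℂ) * I) I t := by
      simpa using ((hasDerivAt_id t).ofReal_comp.mul_const I).const_add (1 / 2 : ℂ)
    have h2 := hasDerivAt_weilMellin hh.1.continuous hh.2 (1 / 2 + t * I)
    have h3 : HasDerivAt (weilMellin h ∘ fun v : ℝ => (1 / 2 : ℂ) + (v : ℂ) * I)
        ((∫ x : ℝ, h x * (x * cexp ((1 / 2 + t * I - 1 / 2) * x))) * I) t := h2.comp t h1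
    have h4 : HasDerivAt (fun v : ℝ => weilMellin h (1 / 2 + v * I))
        ((∫ x : ℝ, h x * (x * cexp ((1 / 2 + t * I - 1 / 2) * x))) * I) t := h3
    refine h4.congr_deriv ?_
    simp only [hu', hk]
    rw [mul_comm, weilMellin]
    congr 1
    refine integral_congr_ae (Eventually.of_forall fun x => ?_)
    simp only
    ring
  have huc : Continuous u := (continuous_weilMellin hh.1.continuous hh.2).comp (by fun_prop)
  have hu'c : Continuous u' :=
    continuous_const.mul ((continuous_weilMellin hkW.1.continuous hkW.2).comp (by fun_prop))
  -- the oscillatory factor `v(t) = e^{-2imφ̃(t)}` and its derivative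
  set v : ℝ → ℂ := fun t => cexp (-(2 * (m : ℂ) * ((ph t : ℝ) : ℂ) * I)) with hv
  set v' : ℝ → ℂ := fun t => -(2 * (m : ℂ) * ((ph' t : ℝ) : ℂ) * I) * v t with hv'
  have hvd : ∀ t, HasDerivAt v (v' t) t := by
    intro t
    have h1 : HasDerivAt (fun s : ℝ => ((ph s : ℝ) : ℂ)) ((ph' t : ℝ) : ℂ) t := (hder t).ofReal_comp
    have h2 : HasDerivAt (fun s : ℝ => -(2 * (m : ℂ) * ((ph s : ℝ) : ℂ) * I))
        (-(2 * (m : ℂ) * ((ph' t : ℝ) : ℂ) * I)) t :=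
      ((h1.const_mul (2 * (m : ℂ))).mul_const I).fun_neg
    have h3 := h2.cexp
    simp only [hv, hv']
    convert h3 using 1
    ring
  have hvn : ∀ t, ‖v t‖ = 1 := by
    intro t
    simp only [hv]
    have : -(2 * (m : ℂ) * ((ph t : ℝ) : ℂ) * I) = ((-(2 * (m : ℝ) * ph t) : ℝ) : ℂ) * I := by
      push_cast; ring
    rw [this, Complex.norm_exp_ofReal_mul_I]
  have hvc : Continuous v := by
    simp only [hv]
    have hphc : Continuous ph := continuous_iff_continuousAt.2 fun t => (hder t).continuousAt
    fun_prop
  have hv'c : Continuous v' := by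
    simp only [hv']
    exact ((continuous_const.mul (continuous_ofReal.comp hph'c)).mul continuous_const).neg.mul hvc
  have hv'n : ∀ t, ‖v' t‖ ≤ 2 * |(m : ℝ)| * (L + C * (1 + |t|) ^ N) := by
    intro t
    simp only [hv']
    rw [norm_mul, hvn, mul_one, norm_neg, norm_mul, norm_mul, norm_mul, Complex.norm_I, mul_one,
      Complex.norm_real, Real.norm_eq_abs, Complex.norm_intCast, Complex.norm_two]
    have := hph'b t
    have h2 : 0 ≤ 2 * |(m : ℝ)| := by positivity
    nlinarith [abs_nonneg (ph' t)]
  -- decay of `u` and `u'`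
  obtain ⟨C₁, hC₁, hdu⟩ := causalCLS_weil_decay_poly N hh
  obtain ⟨C₂, hC₂, hdu0⟩ := causalCLS_weil_decay_poly 0 hh
  obtain ⟨C₃, hC₃, hdk⟩ := causalCLS_weil_decay_poly 0 hkW
  have hu_le : ∀ t, ‖u t‖ ≤ C₂ / (1 + t ^ 2) := fun t => by
    have := hdu0 t
    simp only [pow_zero, one_mul] at this
    exact this
  have hu'_le : ∀ t, ‖u' t‖ ≤ C₃ / (1 + t ^ 2) := fun t => by
    have := hdk t
    simp only [pow_zero, one_mul] at this
    simp only [hu', norm_mul, Complex.norm_I, one_mul]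
    exact this
  -- integrability
  have hint1 : Integrable (u * v') := by
    refine Integrable.mono' ((integrable_inv_one_add_sq.const_mul
      (2 * |(m : ℝ)| * (L * C₂ + C * C₁)))) (huc.mul hv'c).aestronglyMeasurable
      (Eventually.of_forall fun t => ?_)
    simp only [Pi.mul_apply, norm_mul]
    have h1 := hv'n t
    have h2 := hu_le t
    have h3 := hdu t
    have hpos : 0 < 1 + t ^ 2 := by positivity
    calc ‖u t‖ * ‖v' t‖ ≤ ‖u t‖ * (2 * |(m : ℝ)| * (L + C * (1 + |t|) ^ N)) :=
          mul_le_mul_of_nonneg_left h1 (norm_nonneg _)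
      _ = 2 * |(m : ℝ)| * (L * ‖u t‖ + C * ((1 + |t|) ^ N * ‖u t‖)) := by ring
      _ ≤ 2 * |(m : ℝ)| * (L * (C₂ / (1 + t ^ 2)) + C * (C₁ / (1 + t ^ 2))) := by gcongr
      _ = 2 * |(m : ℝ)| * (L * C₂ + C * C₁) * (1 + t ^ 2)⁻¹ := by
          field_simp
  have hint2 : Integrable (u' * v) := by
    refine Integrable.mono' (integrable_inv_one_add_sq.const_mul C₃)
      (hu'c.mul hvc).aestronglyMeasurable (Eventually.of_forall fun t => ?_)
    simp only [Pi.mul_apply, norm_mul, hvn, mul_one]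
    rw [← div_eq_mul_inv]
    exact hu'_le t
  have hint3 : Integrable (u * v) := by
    refine Integrable.mono' (integrable_inv_one_add_sq.const_mul C₂)
      (huc.mul hvc).aestronglyMeasurable (Eventually.of_forall fun t => ?_)
    simp only [Pi.mul_apply, norm_mul, hvn, mul_one]
    rw [← div_eq_mul_inv]
    exact hu_le t
  -- integration by parts
  have hIBP : ∫ t, u t * v' t = -∫ t, u' t * v t :=
    integral_mul_deriv_eq_deriv_mul_of_integrable (fun t _ => hud t) (fun t _ => hvd t)
      hint1 hint2 hint3
  -- the boundary-value integral `∫ u' v` vanishes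
  have hE2 : ∀ t : ℝ, E t / sharp E t = cexp (2 * ((θ t : ℝ) : ℂ) * I) := by
    intro t
    have hEt := hθ t
    set r : ℝ := ‖E t‖ with hr_def
    have hr : (r : ℂ) ≠ 0 := Complex.ofReal_ne_zero.2 (by rw [hr_def]; exact norm_ne_zero_iff.2 (h0r t))
    have hs : sharp E t = (r : ℂ) * cexp (-(((θ t : ℝ) : ℂ) * I)) := by
      rw [Literature.Analysis.DeBrangesSpaces.sharp_ofReal, hEt, map_mul, Complex.conj_ofReal,
        ← Complex.exp_conj, map_mul, Complex.conj_ofReal, Complex.conj_I, mul_neg]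
    rw [hs, hEt, mul_div_mul_left _ _ hr, ← Complex.exp_sub]
    congr 1
    ring
  have hE2' : ∀ t : ℝ, sharp E t / E t = cexp (-(2 * ((θ t : ℝ) : ℂ) * I)) := by
    intro t
    have hs0 : sharp E t ≠ 0 := by
      rw [Literature.Analysis.DeBrangesSpaces.sharp_ofReal, map_ne_zero]; exact h0r t
    rw [← inv_div, hE2 t, ← Complex.exp_neg]
  have hvanish : ∫ t, u' t * v t = 0 := by
    have e1 : (fun t : ℝ => u' t * v t) =
        fun t : ℝ => I * (weilMellin k (1 / 2 + (t : ℂ) * I) * v t) := by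
      funext t; simp only [hu']; ring
    rw [e1, integral_const_mul, mul_eq_zero]
    right
    rcases Int.eq_nat_or_neg m with ⟨n, rfl | rfl⟩
    · -- `m = n ≥ 1`: lower half-plane
      have hn : 1 ≤ n := by
        rcases Nat.eq_zero_or_pos n with h | h
        · exact absurd (by simp [h]) hm
        · exact h
      have e2 : ∀ t : ℝ, v t = (cexp (-(2 * (L : ℂ) * (t : ℂ) * I)) * (E t / sharp E t)) ^ n := by
        intro t
        rw [hE2 t, ← Complex.exp_add, ← Complex.exp_nat_mul]
        simp only [hv, hph]
        congr 1
        push_cast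
        ring
      simp_rw [e2]
      exact causalCLS_alias_lower hE hδ h0 hL.le hAL hkW hkA hn
    · -- `m = -n ≤ -1`: upper half-plane
      have hn : 1 ≤ n := by
        rcases Nat.eq_zero_or_pos n with h | h
        · exact absurd (by simp [h]) hm
        · exact h
      have e2 : ∀ t : ℝ, v t = (cexp (2 * (L : ℂ) * (t : ℂ) * I) * (sharp E t / E t)) ^ n := by
        intro t
        rw [hE2' t, ← Complex.exp_add, ← Complex.exp_nat_mul]
        simp only [hv, hph]
        congr 1
        push_cast
        ring
      simp_rw [e2]
      exact causalCLS_alias_upper _ _ _ _ _ _ hE hδ h0 hL.le hAL hkW hkA hn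
  -- assemble: the integrand is `e^{2imα}/(-2im) · u v'`
  have hmC : (2 * (m : ℂ) * I) ≠ 0 := by
    have : (m : ℂ) ≠ 0 := Int.cast_ne_zero.2 hm
    exact mul_ne_zero (mul_ne_zero two_ne_zero this) Complex.I_ne_zero
  have e3 : (fun t : ℝ => weilMellin h (1 / 2 + (t : ℂ) * I) * ((L - (deriv E t / E t).im : ℝ) : ℂ) *
      cexp (((2 * (m : ℝ) * (α - (L * t - θ t)) : ℝ) : ℂ) * I)) =
      fun t : ℝ => (cexp (2 * (m : ℂ) * (α : ℂ) * I) / (-(2 * (m : ℂ) * I))) * (u t * v' t) := by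
    funext t
    simp only [hu, hv', hv, hph', hph, hℓ]
    have e4 : cexp (((2 * (m : ℝ) * (α - (L * t - θ t)) : ℝ) : ℂ) * I) =
        cexp (2 * (m : ℂ) * (α : ℂ) * I) * cexp (-(2 * (m : ℂ) * (((L * t - θ t : ℝ)) : ℂ) * I)) := by
      rw [← Complex.exp_add]
      congr 1
      push_cast
      ring
    rw [e4]
    field_simp
  rw [e3, integral_const_mul, hIBP, hvanish, neg_zero, mul_zero]

end Summit.RiemannHypothesis.RiemannHypothesis.Theorems.SpectralTraceWindowTraceArch

end
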